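import Mathlib
import Literature.MathematicalPhysics.QuantumFieldTheory.GaussianToolkit
import HarnessLib

/-!
# The Gaussian dilation (score) identity `d/dσ E[F(σξ)] = σ⁻¹ E[F(σξ)(|ξ|² − n)]`

Helper file for the crux `QuadrupoleSelectionRule` (stmt-CriticalPhenomena-7029, informal) of route
`CardyFlipRusso` (sub-problem `CardyFormulaZ2`), line `Sketch` (generation 4), stub R1
(`hasDerivAt_integral_gaussian_dilate`): the `σ`-derivative of an annealed expectation along the
Gaussian-jitter leg L1 (lattice sites `T + σ ξ`, `ξ` i.i.d. standard Gaussian) for a merely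
BOUNDED MEASURABLE function `F` of finitely many jittered coordinates — no geometric measure
theory, no regularity of `F`.

For `ξ ∼ ⊗_{i ∈ ι} 𝒩(0,1)`, `n = |ι|`, `F : ℝ^ι → ℝ` bounded measurable and `σ > 0`:

  `d/ds|_{s=σ} E[F(s ξ)] = σ⁻¹ · E[F(σ ξ) (Σᵢ ξᵢ² − n)]`.

Proof (everything is proved here; besides Mathlib only the tree's `GaussianToolkit` is used, for
the Lebesgue density `∏ᵢ φ(xᵢ) = (2π)^{-n/2} e^{-Σ xᵢ²/2}` of `⊗ⁿ 𝒩(0,1)`):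

* `GaussianDilation.integral_comp_smul_pi_gaussianReal` — for `s > 0` and ANY `H : ℝ^ι → ℝ`,
  `E[H(s ξ)] = ∫ H(y) ρₛ(Σ yᵢ²) dy` with the dilated density
  `ρₛ(t) = ρ[n, s, t] = s⁻ⁿ (2π)^{-n/2} e^{-t/(2s²)}` (density of the product Gaussian plus the
  Haar change of variables `Measure.integral_comp_smul_of_nonneg` on `ℝ^ι`);
* `GaussianDilation.hasDerivAt_kern` — `∂ₛ ρₛ(t) = ρ'[n, s, t] = s⁻¹ ρₛ(t) (t/s² − n)`;
* `GaussianDilation.abs_kernDeriv_le` — on `s ∈ (a, 3a)`, `|∂ₛ ρₛ(t)| ≤ M e^{-b t}` (`t ≥ 0`), and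
  `GaussianDilation.integrable_exp_neg_mul_sumSq` — `e^{-b Σ yᵢ²}` is Lebesgue integrable;
* the deciding theorem then differentiates under the integral sign on the ball `|s − σ| < σ/2`
  (`hasDerivAt_integral_of_dominated_loc_of_deriv_le`) and changes variables back.

The kernels `ρ[n, s, t]`, `ρ'[n, s, t]` are local notations (no definition is introduced). The
case `ι = ∅` needs no separate treatment (both sides are derivatives of constants).
-/

noncomputable section

open MeasureTheory ProbabilityTheory Set Filter Metric
open scoped ENNReal NNReal Topology BigOperators

namespace Summit.CriticalPhenomena.CardyFormulaZ2.Theorems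

open Literature.MathematicalPhysics.QuantumFieldTheory

/-- The Lebesgue density of `s ξ`, `ξ ∼ ⊗ⁿ 𝒩(0,1)`, as a function of `t = Σ yᵢ²`:
`ρ[n, s, t] = s⁻ⁿ (√(2π))⁻ⁿ e^{-t/(2s²)}` (local notation). -/
local notation3 "ρ[" n ", " s ", " t "]" =>
  ((s : ℝ) ^ (n : ℕ))⁻¹ * (Real.sqrt (2 * Real.pi))⁻¹ ^ (n : ℕ) *
    Real.exp (-(2 * (s : ℝ) ^ 2)⁻¹ * (t : ℝ))

/-- The `s`-derivative of `ρ[n, s, t]` (valid for `s ≠ 0`, see `hasDerivAt_kern`):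
`ρ'[n, s, t] = s⁻¹ · ρ[n, s, t] · (t/s² − n)` (local notation). -/
local notation3 "ρ'[" n ", " s ", " t "]" =>
  (s : ℝ)⁻¹ * (ρ[n, s, t] * (((s : ℝ) ^ 2)⁻¹ * (t : ℝ) - ((n : ℕ) : ℝ)))

namespace GaussianDilation

/-! ### The dilated Gaussian kernel and its `s`-derivative -/

/-- `ρ[n, s, t] ≥ 0` for `s > 0`. [folklore] -/
theorem kern_nonneg (n : ℕ) {s : ℝ} (hs : 0 < s) (t : ℝ) : 0 ≤ ρ[n, s, t] := by
  positivity

/-- The power rule without natural-number subtraction: `d/ds sⁿ = n sⁿ / s` at `s ≠ 0`.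
[folklore] -/
theorem hasDerivAt_pow_div (n : ℕ) {s : ℝ} (hs : s ≠ 0) :
    HasDerivAt (fun r : ℝ => r ^ n) (n * s ^ n / s) s := by
  refine (hasDerivAt_pow n s).congr_deriv ?_
  rcases n with _ | m
  · simp
  · rw [Nat.add_sub_cancel, pow_succ, ← mul_assoc, mul_div_cancel_right₀ _ hs]

/-- **The `s`-derivative of the dilated kernel**: for `s ≠ 0`,
`d/dr|_{r=s} ρ[n, r, t] = ρ'[n, s, t] = s⁻¹ ρ[n, s, t] (t/s² − n)`. [folklore] -/
theorem hasDerivAt_kern (n : ℕ) (t : ℝ) {s : ℝ} (hs : s ≠ 0) :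
    HasDerivAt (fun r => ρ[n, r, t]) (ρ'[n, s, t]) s := by
  have hc : Real.sqrt (2 * Real.pi) ≠ 0 := by positivity
  have h2s : (2 : ℝ) * s ^ 2 ≠ 0 := mul_ne_zero two_ne_zero (pow_ne_zero 2 hs)
  have h2 : HasDerivAt (fun r : ℝ => (r ^ n)⁻¹) (-(n * s ^ n / s) / (s ^ n) ^ 2) s :=
    (hasDerivAt_pow_div n hs).fun_inv (pow_ne_zero n hs)
  have h4 : HasDerivAt (fun r : ℝ => (2 * r ^ 2)⁻¹)
      (-(2 * (2 * s ^ 2 / s)) / (2 * s ^ 2) ^ 2) s :=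
    ((hasDerivAt_pow_div 2 hs).const_mul 2).fun_inv h2s
  have h6 : HasDerivAt (fun r : ℝ => Real.exp (-(2 * r ^ 2)⁻¹ * t))
      (Real.exp (-(2 * s ^ 2)⁻¹ * t) * (-(-(2 * (2 * s ^ 2 / s)) / (2 * s ^ 2) ^ 2) * t)) s :=
    (h4.neg.mul_const t).exp
  refine ((h2.mul_const ((Real.sqrt (2 * Real.pi))⁻¹ ^ n)).mul h6).congr_deriv ?_
  field_simp
  ring

/-- `t e^{-β t} ≤ β⁻¹` for `β > 0` (from `1 + u ≤ eᵘ`). [folklore] -/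
theorem mul_exp_neg_mul_le {β : ℝ} (hβ : 0 < β) (t : ℝ) : t * Real.exp (-β * t) ≤ β⁻¹ := by
  have h1 : β * t ≤ Real.exp (β * t) := by linarith [Real.add_one_le_exp (β * t)]
  rw [neg_mul, Real.exp_neg, mul_inv_le_iff₀ (Real.exp_pos _), le_inv_mul_iff₀ hβ]
  exact h1

/-- **Domination of the `s`-derivative of the kernel** on `s ∈ (a, 3a)` (`a > 0`): there are
`M` and `b > 0` (depending on `n, a` only) with `|ρ'[n, s, t]| ≤ M e^{-b t}` for all `t ≥ 0`.
[folklore] -/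
theorem abs_kernDeriv_le (n : ℕ) {a : ℝ} (ha : 0 < a) :
    ∃ M b : ℝ, 0 < b ∧ ∀ s ∈ Set.Ioo a (3 * a), ∀ t : ℝ, 0 ≤ t →
      |ρ'[n, s, t]| ≤ M * Real.exp (-b * t) := by
  have hb : (0 : ℝ) < (2 * (3 * a) ^ 2)⁻¹ / 2 := by positivity
  refine ⟨a⁻¹ * ((a ^ n)⁻¹ * (Real.sqrt (2 * Real.pi))⁻¹ ^ n) *
      ((a ^ 2)⁻¹ * ((2 * (3 * a) ^ 2)⁻¹ / 2)⁻¹ + n),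
    (2 * (3 * a) ^ 2)⁻¹ / 2, hb, fun s hs t ht => ?_⟩
  obtain ⟨has, hs3⟩ := hs
  have hs0 : 0 < s := ha.trans has
  have has' : a ≤ s := has.le
  have hs3' : s ≤ 3 * a := hs3.le
  -- the kernel at `s` is dominated by an envelope depending on `a` only
  have hkern : ρ[n, s, t] ≤ (a ^ n)⁻¹ * (Real.sqrt (2 * Real.pi))⁻¹ ^ n *
      Real.exp (-(2 * (3 * a) ^ 2)⁻¹ * t) := by
    gcongr
  have hsplit : Real.exp (-(2 * (3 * a) ^ 2)⁻¹ * t) =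
      Real.exp (-((2 * (3 * a) ^ 2)⁻¹ / 2) * t) * Real.exp (-((2 * (3 * a) ^ 2)⁻¹ / 2) * t) := by
    rw [← Real.exp_add]
    congr 1
    ring
  have habs : |(s ^ 2)⁻¹ * t - n| ≤ (a ^ 2)⁻¹ * t + n := by
    refine (abs_sub _ _).trans ?_
    rw [abs_of_nonneg (by positivity), Nat.abs_cast]
    gcongr
  have hone : Real.exp (-((2 * (3 * a) ^ 2)⁻¹ / 2) * t) ≤ 1 :=
    Real.exp_le_one_iff.2 (by nlinarith)
  rw [abs_mul, abs_mul, abs_of_pos (inv_pos.2 hs0), abs_of_nonneg (kern_nonneg n hs0 t)]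
  calc s⁻¹ * (ρ[n, s, t] * |(s ^ 2)⁻¹ * t - n|)
      ≤ a⁻¹ * ((a ^ n)⁻¹ * (Real.sqrt (2 * Real.pi))⁻¹ ^ n *
          Real.exp (-(2 * (3 * a) ^ 2)⁻¹ * t) * ((a ^ 2)⁻¹ * t + n)) :=
        mul_le_mul (inv_anti₀ ha has') (mul_le_mul hkern habs (abs_nonneg _) (by positivity))
          (mul_nonneg (kern_nonneg n hs0 t) (abs_nonneg _)) (by positivity)
    _ = a⁻¹ * ((a ^ n)⁻¹ * (Real.sqrt (2 * Real.pi))⁻¹ ^ n) *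
          Real.exp (-((2 * (3 * a) ^ 2)⁻¹ / 2) * t) *
          ((a ^ 2)⁻¹ * (t * Real.exp (-((2 * (3 * a) ^ 2)⁻¹ / 2) * t)) +
            n * Real.exp (-((2 * (3 * a) ^ 2)⁻¹ / 2) * t)) := by
        rw [hsplit]; ring
    _ ≤ a⁻¹ * ((a ^ n)⁻¹ * (Real.sqrt (2 * Real.pi))⁻¹ ^ n) *
          Real.exp (-((2 * (3 * a) ^ 2)⁻¹ / 2) * t) *
          ((a ^ 2)⁻¹ * ((2 * (3 * a) ^ 2)⁻¹ / 2)⁻¹ + n * 1) := by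
        gcongr
        exact mul_exp_neg_mul_le hb t
    _ = a⁻¹ * ((a ^ n)⁻¹ * (Real.sqrt (2 * Real.pi))⁻¹ ^ n) *
          ((a ^ 2)⁻¹ * ((2 * (3 * a) ^ 2)⁻¹ / 2)⁻¹ + n) *
          Real.exp (-((2 * (3 * a) ^ 2)⁻¹ / 2) * t) := by ring

/-! ### The product Gaussian under dilation: a density with respect to Lebesgue measure -/

variable {ι : Type*} [Fintype ι]

/-- `y ↦ e^{-b Σᵢ yᵢ²}` is Lebesgue integrable on `ℝ^ι` for `b > 0` (a finite product of
one-dimensional Gaussian weights). [folklore] -/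
theorem integrable_exp_neg_mul_sumSq {b : ℝ} (hb : 0 < b) :
    Integrable (fun y : ι → ℝ => Real.exp (-b * ∑ i, y i ^ 2)) := by
  have h : ∀ y : ι → ℝ, Real.exp (-b * ∑ i, y i ^ 2) = ∏ i, Real.exp (-b * y i ^ 2) := by
    intro y; rw [Finset.mul_sum, Real.exp_sum]
  simp_rw [h]
  rw [volume_pi]
  exact Integrable.fintype_prod (f := fun _ : ι => fun x : ℝ => Real.exp (-b * x ^ 2))
    fun _ => integrable_exp_neg_mul_sq hb

/-- **Dilation as a change of density.** For `s > 0` and any `H : ℝ^ι → ℝ`,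
`E[H(s ξ)] = ∫ H(y) · ρ[n, s, Σᵢ yᵢ²] dy` (`ξ ∼ ⊗^ι 𝒩(0,1)`, `n = |ι|`, Lebesgue `dy`): the law
of `s ξ` has Lebesgue density `s⁻ⁿ (2π)^{-n/2} e^{-|y|²/(2s²)}`. Both sides are Bochner integrals,
so no integrability hypothesis is needed. [folklore] -/
theorem integral_comp_smul_pi_gaussianReal (H : (ι → ℝ) → ℝ) {s : ℝ} (hs : 0 < s) :
    ∫ x, H (s • x) ∂(Measure.pi fun _ : ι => gaussianReal 0 1) =
      ∫ y, H y * ρ[Fintype.card ι, s, ∑ i, y i ^ 2] := by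
  have hmeas : Measurable fun x : ι → ℝ => ∏ i, gaussianPDF 0 1 (x i) :=
    Finset.measurable_prod _ fun i _ => (measurable_gaussianPDF 0 1).comp (measurable_pi_apply i)
  have hfin : ∀ᵐ x : ι → ℝ, (∏ i, gaussianPDF 0 1 (x i)) < ∞ :=
    ae_of_all _ fun x => by
      rw [GaussianToolkit.prod_gaussianPDF_eq]; exact ENNReal.ofReal_lt_top
  rw [GaussianToolkit.pi_gaussianReal_eq_withDensity,
    integral_withDensity_eq_integral_toReal_smul hmeas hfin]
  set g : (ι → ℝ) → ℝ := fun y =>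
    (Real.sqrt (2 * Real.pi))⁻¹ ^ Fintype.card ι * Real.exp (-(∑ i, (s⁻¹ • y) i ^ 2) / 2) * H y
    with hg
  have step1 : ∀ x : ι → ℝ, (∏ i, gaussianPDF 0 1 (x i)).toReal • H (s • x) = g (s • x) := by
    intro x
    rw [GaussianToolkit.prod_gaussianPDF_eq, ENNReal.toReal_ofReal (by positivity), smul_eq_mul,
      hg]
    simp only [inv_smul_smul₀ hs.ne']
  calc ∫ x, (∏ i, gaussianPDF 0 1 (x i)).toReal • H (s • x)
      = ∫ x, g (s • x) := integral_congr_ae (ae_of_all _ step1)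
    _ = (s ^ Module.finrank ℝ (ι → ℝ))⁻¹ • ∫ y, g y :=
        Measure.integral_comp_smul_of_nonneg volume g s (hR := hs.le)
    _ = ∫ y, H y * ρ[Fintype.card ι, s, ∑ i, y i ^ 2] := by
        rw [Module.finrank_fintype_fun_eq_card, smul_eq_mul, ← integral_const_mul]
        refine integral_congr_ae (ae_of_all _ fun y => ?_)
        have e : Real.exp (-(∑ i, (s⁻¹ • y) i ^ 2) / 2) =
            Real.exp (-(2 * s ^ 2)⁻¹ * ∑ i, y i ^ 2) := by
          congr 1
          simp only [Pi.smul_apply, smul_eq_mul, mul_pow, ← Finset.mul_sum]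
          ring
        simp only [hg, e]
        ring

end GaussianDilation

open GaussianDilation in
/-- **Gaussian dilation (score) identity** (stub R1 of line `Sketch`, generation 4, crux
`QuadrupoleSelectionRule`). Let `ξ = (ξᵢ)_{i ∈ ι}` be i.i.d. standard real Gaussians
(`Measure.pi fun _ ↦ gaussianReal 0 1`), `n = |ι|`, and let `F : ℝ^ι → ℝ` be measurable with
`|F| ≤ C`. Then for every `σ > 0` the annealed expectation `s ↦ E[F(s ξ)]` is differentiable at
`σ` with

  `d/ds|_{s=σ} E[F(s ξ)] = σ⁻¹ · E[F(σ ξ) · (Σᵢ ξᵢ² − n)]`.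

(The law of `s ξ` has Lebesgue density `ρₛ(y) = s⁻ⁿ(2π)^{-n/2} e^{-|y|²/(2s²)}` with
`∂ₛ ρₛ = s⁻¹ ρₛ (|y/s|² − n)`; differentiate `∫ F ρₛ` under the integral sign, dominated on
`|s − σ| < σ/2`, and change variables back.) [folklore] -/
theorem hasDerivAt_integral_gaussian_dilate : ∀ (ι : Type*) [Fintype ι] (F : (ι → ℝ) → ℝ),
    Measurable F → ∀ C : ℝ, (∀ x, |F x| ≤ C) → ∀ σ : ℝ, 0 < σ →
    HasDerivAt
      (fun s : ℝ => ∫ x, F (s • x) ∂(MeasureTheory.Measure.pi fun _ : ι =>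
        ProbabilityTheory.gaussianReal 0 1))
      (σ⁻¹ * ∫ x, F (σ • x) * (∑ i, x i ^ 2 - (Fintype.card ι : ℝ))
        ∂(MeasureTheory.Measure.pi fun _ : ι => ProbabilityTheory.gaussianReal 0 1)) σ := by
  intro ι _ F hF C hC σ hσ
  have hσ2 : 0 < σ / 2 := half_pos hσ
  obtain ⟨M, b, hb, hM⟩ := abs_kernDeriv_le (Fintype.card ι) hσ2
  have hmk : ∀ s : ℝ, Measurable fun y : ι → ℝ => ρ[Fintype.card ι, s, ∑ i, y i ^ 2] := by
    intro s; fun_prop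
  have hmk' : ∀ s : ℝ, Measurable fun y : ι → ℝ => ρ'[Fintype.card ι, s, ∑ i, y i ^ 2] := by
    intro s; fun_prop
  have hball : ball σ (σ / 2) ∈ 𝓝 σ := ball_mem_nhds σ hσ2
  have hmem : ∀ s ∈ ball σ (σ / 2), s ∈ Set.Ioo (σ / 2) (3 * (σ / 2)) := by
    intro s hs
    rw [mem_ball, Real.dist_eq, abs_lt] at hs
    constructor <;> linarith [hs.1, hs.2]
  -- integrability of `F · ρ_σ`
  have hint : Integrable (fun y : ι → ℝ => F y * ρ[Fintype.card ι, σ, ∑ i, y i ^ 2]) := by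
    have hk : Integrable (fun y : ι → ℝ => ρ[Fintype.card ι, σ, ∑ i, y i ^ 2]) :=
      (integrable_exp_neg_mul_sumSq (by positivity)).const_mul _
    exact hk.bdd_mul hF.aestronglyMeasurable
      (ae_of_all _ fun y => by rw [Real.norm_eq_abs]; exact hC y)
  -- domination of `F · ∂ₛ ρₛ` on the ball
  have hbound : ∀ y : ι → ℝ, ∀ s ∈ ball σ (σ / 2),
      ‖F y * ρ'[Fintype.card ι, s, ∑ i, y i ^ 2]‖ ≤
        C * (M * Real.exp (-b * ∑ i, y i ^ 2)) := by
    intro y s hs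
    rw [norm_mul, Real.norm_eq_abs, Real.norm_eq_abs]
    exact mul_le_mul (hC y) (hM s (hmem s hs) _ (Finset.sum_nonneg fun i _ => sq_nonneg (y i)))
      (abs_nonneg _) ((abs_nonneg _).trans (hC y))
  -- pointwise derivative
  have hdiff : ∀ y : ι → ℝ, ∀ s ∈ ball σ (σ / 2),
      HasDerivAt (fun r : ℝ => F y * ρ[Fintype.card ι, r, ∑ i, y i ^ 2])
        (F y * ρ'[Fintype.card ι, s, ∑ i, y i ^ 2]) s := by
    intro y s hs
    have hs0 : s ≠ 0 := (hσ2.trans (hmem s hs).1).ne'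
    exact (hasDerivAt_kern (Fintype.card ι) (∑ i, y i ^ 2) hs0).const_mul (F y)
  have key : HasDerivAt (fun s : ℝ => ∫ y, F y * ρ[Fintype.card ι, s, ∑ i, y i ^ 2])
      (∫ y, F y * ρ'[Fintype.card ι, σ, ∑ i, y i ^ 2]) σ :=
    (hasDerivAt_integral_of_dominated_loc_of_deriv_le (μ := volume)
      (F := fun s y => F y * ρ[Fintype.card ι, s, ∑ i, y i ^ 2])
      (F' := fun s y => F y * ρ'[Fintype.card ι, s, ∑ i, y i ^ 2])
      (bound := fun y => C * (M * Real.exp (-b * ∑ i, y i ^ 2))) hball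
      (Eventually.of_forall fun s => (hF.mul (hmk s)).aestronglyMeasurable) hint
      (hF.mul (hmk' σ)).aestronglyMeasurable (ae_of_all _ hbound)
      (((integrable_exp_neg_mul_sumSq hb).const_mul M).const_mul C) (ae_of_all _ hdiff)).2
  have heq : (fun s : ℝ => ∫ x, F (s • x) ∂(Measure.pi fun _ : ι => gaussianReal 0 1)) =ᶠ[𝓝 σ]
      fun s => ∫ y, F y * ρ[Fintype.card ι, s, ∑ i, y i ^ 2] := by
    filter_upwards [Ioi_mem_nhds hσ] with s hs
    exact integral_comp_smul_pi_gaussianReal F hs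
  refine (key.congr_of_eventuallyEq heq).congr_deriv ?_
  -- identify the derivative: change variables back
  have h3 : ∫ x, F (σ • x) * ((σ ^ 2)⁻¹ * (∑ i, (σ • x) i ^ 2) - Fintype.card ι)
      ∂(Measure.pi fun _ : ι => gaussianReal 0 1) =
      ∫ y, F y * ((σ ^ 2)⁻¹ * (∑ i, y i ^ 2) - Fintype.card ι) *
        ρ[Fintype.card ι, σ, ∑ i, y i ^ 2] :=
    integral_comp_smul_pi_gaussianReal
      (fun y => F y * ((σ ^ 2)⁻¹ * (∑ i, y i ^ 2) - Fintype.card ι)) hσ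
  have h4 : ∀ x : ι → ℝ, F (σ • x) * (∑ i, x i ^ 2 - (Fintype.card ι : ℝ)) =
      F (σ • x) * ((σ ^ 2)⁻¹ * (∑ i, (σ • x) i ^ 2) - Fintype.card ι) := by
    intro x
    congr 2
    simp only [Pi.smul_apply, smul_eq_mul, mul_pow, ← Finset.mul_sum]
    rw [inv_mul_cancel_left₀ (pow_ne_zero 2 hσ.ne')]
  calc ∫ y, F y * ρ'[Fintype.card ι, σ, ∑ i, y i ^ 2]
      = σ⁻¹ * ∫ y, F y * ((σ ^ 2)⁻¹ * (∑ i, y i ^ 2) - Fintype.card ι) *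
          ρ[Fintype.card ι, σ, ∑ i, y i ^ 2] := by
        rw [← integral_const_mul]
        refine integral_congr_ae (ae_of_all _ fun y => ?_)
        ring
    _ = σ⁻¹ * ∫ x, F (σ • x) * (∑ i, x i ^ 2 - (Fintype.card ι : ℝ))
          ∂(Measure.pi fun _ : ι => gaussianReal 0 1) := by
        rw [← h3]
        congr 1
        exact integral_congr_ae (ae_of_all _ fun x => (h4 x).symm)

end Summit.CriticalPhenomena.CardyFormulaZ2.Theorems

end
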